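import Summits.BirchSwinnertonDyer.Rank1Residual.X11b.BDPRouteOddPrime
import Summits.BirchSwinnertonDyer.Rank1Residual.X11b.BDPRouteManin
import Summits.BirchSwinnertonDyer.Rank1Residual.WAll.AltClosersManinCells
import Literature.NumberTheory.EllipticCurves.NeronIsogenyScalingHoldsProofs
import HarnessLib

/-!
# Route `AdditiveKolyvaginRoad`, Manin children of `ManinGoodOddFrameAdditive`: the odd Heegner
# frame from ANY datum with `p ∤ c`, and the datum for a class of Kodaira type `Iₙ*` at `p`
# (route-independent machinery; `--supports` stmt-BirchSwinnertonDyer-20093 `ManinFrameIstarClass`)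

Cell `pub/bsd-wall` (D-0120, W-ALL lane 3, row 2), seat `bsd-wall-akr-p2` (prover). THEOREMS ONLY
(no definition, no named fact, no `sorry`); nothing is booked. NO route file is imported (theses-cone
hygiene): the item proofs that consume this file (`AdditiveKolyvaginRoadManinFrameIstarClass.lean`,
later the residue item) import the route file themselves.

CONTENT.
* §1 `exists_maninDatum_of_exists_not_dvd`, `exists_oddHeegnerFrame_of_exists_not_dvd` — **the
  9-conjunct frame of `ManinGoodOddFrameAdditive` at an odd prime `p` from ANY parametrisation datum
  of `W` at level `N(W)` with `p ∤ c`** (the shape of `X11b.exists_oddHeegnerData`, Jetchev–Skinner–Wan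
  2017 §7.4.1, with the Manin input abstracted): the Hoffstein–Luo field `K` (`d_K` odd, `d_K < −4`
  so `w_K = 2`, every `ℓ ∣ N` and `p` split so `p ∤ d_K`, `L(E^{(d_K)},1) ≠ 0`;
  `exists_admissibleField_of_rootNumber_eq_neg_one` from Hoffstein–Luo `hHL` + sign `−1` by
  modularity `hnf` and `r_an = 1`), Darmon's Thm. 3.6 point (tree theorem
  `heegnerPointComplex_mem_range_map_holds`), a globally minimal model of the twist.
* §2 `exists_modularParametrizationData_not_dvd_of_istarClass` — **a datum of `W` at level `N` with
  `p ∤ c` when every globally minimal `W₀ ∼ W` has Kodaira type `Iₙ*` at the place of `ℤ` under the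
  odd prime `p` and `E[p]` is irreducible**: the road of
  `AdditiveKolyvaginRoadManinFrameOffExceptionClass.lean` (item 20092) with Edixhoven 1991 Thm. 3
  replaced, AT THE STRONG CURVE, by the tree THEOREM `not_dvd_maninConstant_of_kodairaSymbolAt_eq_Istar`
  (the "Mazur and Stevens" clause of Edixhoven 1991 §1: the `p*`-twist of a type-`Iₙ*` curve is
  good, resp. multiplicative, at `p`; Stevens 1989 Lemmas (5.2)/(5.4) proved in the tree; valid at
  EVERY odd prime, so `p ∈ {5, 7}` included) in its lane-2 re-keying
  `WAll.maninDatum_of_kodairaSymbolAt_eq_Istar`: the `X₀(N)`-optimal curve `W₀ ∼ W` with its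
  lattice-optimal datum `D₀` (`exists_optimal_modularParametrizationData_of_modularity`,
  `exists_optimalDatum'`, `latticeEq_of_modularDegree_le`), `p ∤ c₀` at `W₀` (modulo the named facts
  `hM` Mazur 1978 Cor. 4.1, `hAU` Abbes–Ullmo 1996 Thm. A, `hC2` Česnavičius 2018 Thm. 1.2 at
  `2 ∥ N`, and `hnf`), a prime-to-`p` integral multiplier `k Λ_{W₀} ⊆ Λ_W`
  (`X11b.exists_int_mul_mem_lattice_not_dvd`, uses `Irr`; the Néron mapping property is the tree
  THEOREM `integral_neronScaling_of_isGloballyMinimal_holds`), and the datum `(f, Λ_W, k c₀)`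
  (`ModularParametrizationData.exists_of_isNewformOf`).

References: [EdixhovenManin1991] §1 (typescript L96–101) and Thm. 3; [Stevens1989] Lemmas (5.2),
(5.4); [Mazur1978] Cor. 4.1; [AbbesUllmo1996] Thm. A; [Cesnavicius2018] Thm. 1.2;
[JetchevSkinnerWan2017] §7.4.1, Remark 43; [AgasheRibetStein2006] Thm. 2.6; [HoffsteinLuo1997]
Theorem (§1); [Darmon2004] Thm. 3.6; [SilvermanATAEC1994] IV.11.1 table p. 368.
-/

set_option autoImplicit false
-- the Theorems directory repeats the summit name (sibling precedent `SignedBaseChangeAssembly.lean`)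
set_option linter.dupNamespace false

noncomputable section

open scoped Classical

open WeierstrassCurve NumberField IsDedekindDomain Rat.HeightOneSpectrum
  Literature.NumberTheory.DiophantineGeometry Literature.NumberTheory.EllipticCurves
  Literature.NumberTheory.EllipticCurves.ModularForms
  Literature.NumberTheory.EllipticCurves.Rank1Residual Literature.NumberTheory.Automorphic
  Summit.BirchSwinnertonDyer.Rank1Residual

namespace Summit.BirchSwinnertonDyer.BirchSwinnertonDyer.Theorems.ManinFrameFromDatum

/-! ### §1 The odd Heegner frame from ANY datum with `p ∤ c` -/

/-- **The Manin-unit Heegner datum from a datum with `p ∤ c`**: given a parametrisation datum `Dt`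
of `W` at level `N` with `p ∤ c(Dt)`, an imaginary quadratic `K` with the Heegner hypothesis for
`N` carries a Heegner datum `H` of discriminant `d_K`, an embedding `ι`, and `P ∈ E(K)` mapping to
the complex Heegner point (Darmon 2004 Thm. 3.6, tree theorem
`heegnerPointComplex_mem_range_map_holds`). [cite: Darmon2004, Thm. 3.6–3.7 (PDF pp. 43–44)] -/
theorem exists_maninDatum_of_exists_not_dvd
    (W : WeierstrassCurve ℚ) [W.IsElliptic] (p : ℕ) (N : ℕ) [NeZero N]
    (K : Type) [Field K] [NumberField K]
    (hD : ∃ Dt : ModularParametrizationData W N, ¬ (p : ℤ) ∣ Dt.c)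
    (hK : IsImaginaryQuadratic K) (hH : SatisfiesHeegnerHypothesis N K) :
    ∃ (Dt : ModularParametrizationData W N) (H : HeegnerDatum N (NumberField.discr K))
      (ι : K →+* ℂ) (P : (W.baseChange K).toAffine.Point),
      WeierstrassCurve.Affine.Point.map ι.toRatAlgHom P = heegnerPointComplex Dt H ∧
        ¬ (p : ℤ) ∣ Dt.c := by
  obtain ⟨Dt, hDt⟩ := hD
  obtain ⟨β, hβ⟩ := exists_dvd_sq_sub_discr_holds N K hK hH
  obtain ⟨H, -⟩ := nonempty_heegnerDatum_holds N K hK hβ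
  obtain ⟨ι⟩ : Nonempty (K →+* ℂ) := inferInstance
  obtain ⟨P, hP⟩ := heegnerPointComplex_mem_range_map_holds N W K hK hH Dt H ι
  exact ⟨Dt, H, ι, P, hP, hDt⟩

/-- **The odd Heegner frame at an odd prime `p` from ANY datum with `p ∤ c`** — the conclusion of
`ManinGoodOddFrameAdditive` (shape of `X11b.exists_oddHeegnerData`, the Manin input abstracted):
for `W/ℚ` globally minimal with `r_an = 1`, `p` odd, and SOME parametrisation datum of `W` at level
`N = N(W)` with `p ∤ c`: a Hoffstein–Luo field `K` (`d_K` odd, `d_K < −4` so `w_K = 2`, every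
`ℓ ∣ N` and `p` split so `p ∤ d_K`, `L(E^{(d_K)},1) ≠ 0`;
`exists_admissibleField_of_rootNumber_eq_neg_one` from `hHL` + sign `−1` by `hnf`), the Manin-unit
datum (`exists_maninDatum_of_exists_not_dvd`), and a globally minimal model of the twist.
[cite: HoffsteinLuo1997, Theorem (§1, pp. 435–436)] [cite: Darmon2004, Thm. 3.6] -/
theorem exists_oddHeegnerFrame_of_exists_not_dvd (hnf : exists_isNewformOf)
    (hHL : HoffsteinLuo1997_exists_twist_L_one_ne_zero)
    (W : WeierstrassCurve ℚ) [W.IsElliptic] [W.IsGloballyMinimal] (p : ℕ) [hp : Fact p.Prime]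
    [NeZero (W.conductorNorm ℤ)] (hr : W.analyticRank = 1) (hp2 : p ≠ 2)
    (hD : ∃ Dt : ModularParametrizationData W (W.conductorNorm ℤ), ¬ (p : ℤ) ∣ Dt.c) :
    ∃ (K : Type) (_ : Field K) (_ : NumberField K)
      (Dt : ModularParametrizationData W (W.conductorNorm ℤ))
      (H : HeegnerDatum (W.conductorNorm ℤ) (NumberField.discr K)) (ι : K →+* ℂ)
      (P : (W.baseChange K).toAffine.Point)
      (Wd : WeierstrassCurve ℚ) (_ : Wd.IsElliptic) (_ : Wd.IsGloballyMinimal) (Cd : VariableChange ℚ),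
      IsImaginaryQuadratic K ∧ Odd (NumberField.discr K) ∧ ¬ (p : ℤ) ∣ NumberField.discr K ∧
        SatisfiesHeegnerHypothesis (W.conductorNorm ℤ) K ∧
        WeierstrassCurve.Affine.Point.map ι.toRatAlgHom P = heegnerPointComplex Dt H ∧
        ¬ (p : ℤ) ∣ Dt.c ∧ ¬ p ∣ Units.torsionOrder K ∧
        (W.quadraticTwist (NumberField.discr K : ℚ)).entireLFunction 1 ≠ 0 ∧
        Cd • W.quadraticTwist (NumberField.discr K : ℚ) = Wd := by
  have hpP : p.Prime := hp.out
  -- the sign of the functional equation is `−1` (modularity, `r_an = 1`)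
  have hw : W.rootNumber = -1 := by
    rw [WeierstrassCurve.rootNumber_eq_neg_one_pow_analyticRank_of_exists_isNewformOf hnf W, hr]
    norm_num
  -- the Hoffstein–Luo field: `d_K ≡ 1 (mod 8)`, `d_K < −4`, every `ℓ ∣ N` and `p` split
  obtain ⟨K, _, _, hK, hodd, hlt, hHN, hHp, hLt⟩ :=
    exists_admissibleField_of_rootNumber_eq_neg_one hnf hHL W hw p
  have hpd : ¬ (p : ℤ) ∣ NumberField.discr K := not_dvd_discr_of_split hK hpP hp2 hHp
  -- `w_K = 2`, prime to the odd prime `p`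
  have hμ : ¬ p ∣ Units.torsionOrder K := by
    haveI : IsTotallyComplex K := hK.2
    rw [Literature.NumberTheory.DiophantineGeometry.torsionOrder_eq_two_of_discr_lt hK.1 hlt]
    intro h2
    have := Nat.le_of_dvd two_pos h2
    have := hpP.two_le
    omega
  -- the Heegner datum with `p ∤ c`
  obtain ⟨Dt, H, ι, P, hP, hc⟩ :=
    exists_maninDatum_of_exists_not_dvd W p (W.conductorNorm ℤ) K hD hK hHN
  -- a globally minimal model of the twist
  have hD0 : (NumberField.discr K : ℚ) ≠ 0 := by exact_mod_cast NumberField.discr_ne_zero K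
  haveI hEt : (W.quadraticTwist (NumberField.discr K : ℚ)).IsElliptic :=
    W.isElliptic_quadraticTwist hD0
  obtain ⟨Cd, hCd⟩ := hasGlobalMinimalModel_rat_holds (W.quadraticTwist (NumberField.discr K : ℚ))
  exact ⟨K, inferInstance, inferInstance, Dt, H, ι, P, Cd • W.quadraticTwist (NumberField.discr K : ℚ),
    inferInstance, hCd, Cd, hK, hodd, hpd, hHN, hP, hc, hμ, hLt, rfl⟩

/-! ### §2 A datum of `W` at level `N` with `p ∤ c`, for a class of type `Iₙ*` at `p` -/

/-- **A datum of `E` at level `N` with Manin constant prime to `p`, for a class of Kodaira type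
`Iₙ*` at the odd prime `p`** (the Mazur–Stevens twin of
`X11b.exists_modularParametrizationData_not_dvd`): `W/ℚ` globally minimal of conductor `N`, `p` odd
with `E[p]` irreducible, every globally minimal `W₀ ∼ W` of type `Iₙ*` (some `n`) at a place `v`
of `ℤ` with `natGenerator v = p` (`hIstT`). Inputs: Modularity `hnf` (optimal curve and its
minimal-degree datum `D₀`, lattice-optimal), the tree theorem
`not_dvd_maninConstant_of_kodairaSymbolAt_eq_Istar` at `W₀` through its lane-2 re-keying
`WAll.maninDatum_of_kodairaSymbolAt_eq_Istar` (`p ∤ c₀`, modulo `hM`, `hAU`, `hC2`), the Néron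
mapping property (tree theorem `integral_neronScaling_of_isGloballyMinimal_holds`, through
`X11b.exists_int_mul_mem_lattice_not_dvd`: `k Λ_{W₀} ⊆ Λ_W`, `p ∤ k`); the datum is `(f, Λ_W, k c₀)`.
[cite: EdixhovenManin1991, §1 (typescript L96–101)] [cite: Stevens1989, Lemmas (5.2), (5.4)]
[cite: JetchevSkinnerWan2017, §7.4.1 (p. 30) and Remark 43] [cite: AgasheRibetStein2006, Thm. 2.6 and §2] -/
theorem exists_modularParametrizationData_not_dvd_of_istarClass (hnf : exists_isNewformOf)
    (hM : mazur_not_dvd_maninConstant_of_odd)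
    (hAU : abbesUllmo_not_dvd_maninConstant_of_not_dvd_level)
    (hC2 : cesnavicius_not_two_dvd_maninConstant_of_two_dvd_level)
    (W : WeierstrassCurve ℚ) [W.IsElliptic] [W.IsGloballyMinimal] {N : ℕ} [NeZero N]
    (hN : W.conductorNorm ℤ = N) (p : ℕ) [hp : Fact p.Prime] (hp2 : p ≠ 2) (hirr : Irr W p)
    (hIstT : ∀ (W₀ : WeierstrassCurve ℚ) [W₀.IsElliptic] [W₀.IsGloballyMinimal], IsIsogenous W W₀ →
      ∃ (v : HeightOneSpectrum ℤ) (n : ℕ), natGenerator v = p ∧ W₀.kodairaSymbolAt v = .Istar n) :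
    ∃ Dt : ModularParametrizationData W N, ¬ (p : ℤ) ∣ Dt.c := by
  haveI : (W.baseChange ℂ).IsElliptic := by rw [WeierstrassCurve.baseChange]; infer_instance
  -- the optimal curve `W₀ ~ W` of the class, with its datum `D₀` of minimal degree
  obtain ⟨W₀, hW₀, hW₀min, D₀, hfW, hisoW, hmin⟩ :=
    exists_optimal_modularParametrizationData_of_modularity hnf N W hN
  haveI := hW₀
  haveI := hW₀min
  -- minimal degree forces lattice-optimality `Λ_{W₀} = c₀ Λ_f`
  obtain ⟨W₁, hW₁, D₁, hf₁, h₁⟩ := D₀.exists_optimalDatum'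
  haveI := hW₁
  have hopt : ∀ z ∈ D₀.L.lattice, ∃ w ∈ periodLattice D₀.f, z = D₀.c * w :=
    D₀.latticeEq_of_modularDegree_le D₁ hf₁ h₁ (hmin W₁ D₁ hf₁)
  -- Mazur–Stevens (Edixhoven 1991 §1) at the strong curve: type `Iₙ*` at `p` gives `p ∤ c₀`
  obtain ⟨v, n, hv, hK⟩ := hIstT W₀ hisoW
  have hc₀ : ¬ (p : ℤ) ∣ D₀.c :=
    WAll.maninDatum_of_kodairaSymbolAt_eq_Istar hM hAU hC2 hnf W₀ D₀ hopt p hp2 v hv hK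
  -- an integral multiplier `k : Λ_{W₀} → Λ_W` prime to `p` (Néron mapping property, a theorem)
  obtain ⟨LW, hLW⟩ := exists_isNeronLatticeOf_holds (W.baseChange ℂ)
  obtain ⟨k, hk0, hpk, hk⟩ :=
    X11b.exists_int_mul_mem_lattice_not_dvd integral_neronScaling_of_isGloballyMinimal_holds
      hisoW.symm_of_charZero D₀.isNeronLattice hLW hp.out hirr
  -- the datum `(f, Λ_W, k c₀)` of `W`
  have hm0 : k * D₀.c ≠ 0 := mul_ne_zero hk0 D₀.maninConstant_ne_zero_holds
  have hle : ∀ z ∈ periodLattice D₀.f, ((k * D₀.c : ℤ) : ℂ) * z ∈ LW.lattice := fun z hz ↦ by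
    have h2 := hk _ (D₀.smul_periodLattice_le z hz)
    rwa [← mul_assoc, ← Int.cast_mul] at h2
  obtain ⟨D, -, -, hDc⟩ := ModularParametrizationData.exists_of_isNewformOf hfW hLW hm0 hle
  refine ⟨D, fun hdvd ↦ ?_⟩
  rw [hDc] at hdvd
  rcases (Nat.prime_iff_prime_int.mp hp.out).dvd_or_dvd hdvd with h | h
  · exact hpk h
  · exact hc₀ h

end Summit.BirchSwinnertonDyer.BirchSwinnertonDyer.Theorems.ManinFrameFromDatum

end
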